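import Summits.QuantumFields.YangMills.Theorems.BalabanUVNodesN21ResponseRoadAtRegularSet

/-!
# N21 (NE7c) · THE RESPONSE ROAD's RADIUS BINDER HALVED: part 34's `hRT` from the quadratic-response letter on NEAR
# pairs only, so `R < r` replaces `2R < r` in g0's ★ and in g2's file 8 ★★★ (WIDTH-209 N21, ASK-NEXT (b) of l.32383)

Width seat pub-ymgap-dag-n21-w3 (g4), node N21 = NE7c (NOT PRINTED in [Bałaban 1983–89], NOT proved), lane K3⁷
`SpineGivenEndpointR13SepCoPH` (stmt-QuantumFields-20544, `--kind proof --supports … --as helper`).  Hygiene edition of this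
seat's response road (g0 files 1–2 p583660 ∕ p585983, g2 file 8 p598568), asked for by dag-n21-w7 g0′ («a relaxed f8 would be
consumed by name unchanged»).

WHY.  File 1's radial device (part 20's `affine_radialTransversal_perturbed` about the centre `c`) only ever compares points
ON ONE RAY from `c` inside the kept cut `K ⊆ closedBall c R`: the pairs `(c, w)`, `(w, c)` and `(w, c + s•(w − c))`, all at
mutual distance `≤ R`.  Files 1–2 nevertheless ask the quadratic-response letter for ALL pairs of `K` and feed it from the
Cauchy rung, which forces `diam K ≤ 2R < r` (file 2's `hRr : 2 * R < r`, inherited by file 8 ★★★ and file 12).  Asking the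
letter on NEAR pairs (`‖w′ − w‖ ≤ R`) gives the same conclusions with `R < r`: the analyticity radius need only exceed the
cut's RADIUS, not its diameter — the response-road twin of file 4's (p611900) removal of `hdiam` on the convexity road.
In print's regime the numeral `c₀ + 4(2B∕r²)R² ≤ (1 − κ₀)θ(1 − ρ)` keeps `R ≪ r` anyway; this is hygiene, not a rescue.

WHAT (THEOREMS ONLY; 0 `def`, 0 `sorry`).
* §1 [textbook] NEAR-PAIR variants of file 1 §1–§2 (letter `hT : ∀ w w′ ∈ K, ‖w′ − w‖ ≤ R → ‖Φ w′ − Φ w − L_w(w′ − w)‖ ≤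
  M‖w′ − w‖²`): `linearisation_diff_le_of_quadraticResponseNear`, `radialRemainder_le_of_quadraticResponseNear`,
  `radialTransversal_of_quadraticResponseNear`, `radialTransversal_iSup_of_quadraticResponseNear` — proofs = file 1's
  with the three distances certified `≤ R`.
* §2 ★ `hRT_of_quadraticResponseNear`: file 1 §3 (part 34's `hRT` VERBATIM) from the near letter.
* §3 ★′ `hRT_of_analyticResponse_near`: file 2 ★ with `hRr : R < r` — the Cauchy rung
  `N21AnalyticResponseRemainder.quadraticRemainder_of_differentiableOn_ball` applied per near pair (`‖x′ − x‖ ≤ R < r`).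
* §4 ★★★′ `hRT_of_blockExpChart_regular_near`: file 8 ★★★ with `hRr : R < r`; every other binder and the conclusion
  VERBATIM (file 8's `cutLetters_of_blockExpChart_regular` + §3).
A2∕A6: the binder lists are file 2's ∕ file 8's with ONE binder weakened, so this seat's sanity witnesses (p589278 v1.1
p603813; p600431) inhabit them unchanged.

HONEST FRAMING.  [textbook]∕[bookkeeping] over files 1 ∕ 2 ∕ 8 and part 20 BY NAME; located letters (`M = 2B∕r²`, `R`,
`c₀`, `κ₀`, the NODE-O clause) NOT asserted; nothing of Bałaban's asserted; (M1) ∕ NE7c NOT PRINTED ∕ NOT proved; N21 NOT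
discharged; K3⁷ NOT claimed; counts unmoved (typed 28∕28 · discharged 5∕27); count-neutral; one finite 𝕋⁴ at fixed ε — the
Yang–Mills mass gap (Clay) is NOT proved by any of this: R4 closes the conditional finite-𝕋⁴ rung `BalabanLadder.UV` only;
nothing continuum ∕ ℝ⁴ ∕ OS.
-/

set_option autoImplicit false

noncomputable section

open NormedSpace Metric Set Function Matrix

namespace Summit.QuantumFields.YangMills.Theorems.N21ResponseRadialTransversalityNear

open Summit.QuantumFields.YangMills.Theorems.N21DilationRadialInputs
  (affine_radialTransversal_perturbed radialTransversal_iSup)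
open Summit.QuantumFields.YangMills.Theorems.N21AnalyticResponseRemainder
  (quadraticRemainder_of_differentiableOn_ball norm_realToComplex_pi)
open Summit.QuantumFields.YangMills.Theorems.N21ResponseRoadAtRegularSet (cutLetters_of_blockExpChart_regular)

/-! ## §1  File 1's radial device from the NEAR-PAIR letter -/

section Near

variable {V E : Type*} [NormedAddCommGroup V] [NormedSpace ℝ V] [NormedAddCommGroup E] [NormedSpace ℝ E]

/-- two linearisations at NEAR points differ by `2M‖w′ − w‖²` in the joining direction (file 1 §1 on near pairs). [textbook] -/
theorem linearisation_diff_le_of_quadraticResponseNear (Φ : V → E) (L : V → V →ₗ[ℝ] E) {K : Set V} {M R : ℝ}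
    (hT : ∀ w ∈ K, ∀ w' ∈ K, ‖w' - w‖ ≤ R → ‖Φ w' - Φ w - L w (w' - w)‖ ≤ M * ‖w' - w‖ ^ 2)
    {w w' : V} (hw : w ∈ K) (hw' : w' ∈ K) (hnear : ‖w' - w‖ ≤ R) :
    ‖L w (w' - w) - L w' (w' - w)‖ ≤ 2 * M * ‖w' - w‖ ^ 2 := by
  have h1 := hT w hw w' hw' hnear
  have h2 := hT w' hw' w hw (by rwa [norm_sub_rev])
  have hneg : w - w' = -(w' - w) := (neg_sub w' w).symm
  rw [hneg, map_neg, norm_neg] at h2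
  have hdec : L w (w' - w) - L w' (w' - w)
      = -(Φ w' - Φ w - L w (w' - w)) - (Φ w - Φ w' - -(L w' (w' - w))) := by abel
  rw [hdec]
  calc ‖-(Φ w' - Φ w - L w (w' - w)) - (Φ w - Φ w' - -(L w' (w' - w)))‖
      ≤ ‖-(Φ w' - Φ w - L w (w' - w))‖ + ‖Φ w - Φ w' - -(L w' (w' - w))‖ := norm_sub_le _ _
    _ ≤ M * ‖w' - w‖ ^ 2 + M * ‖w' - w‖ ^ 2 := by rw [norm_neg]; exact add_le_add h1 h2
    _ = 2 * M * ‖w' - w‖ ^ 2 := by ring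

/-- the radial remainder about the centre is radially Lipschitz with `γ = 3MR²` — from the near-pair letter: the pairs
used, `(w, c + s•(w − c))` and `(c, w)`, are at distance `(s − 1)‖w − c‖ ≤ R` and `‖w − c‖ ≤ R`. [textbook] -/
theorem radialRemainder_le_of_quadraticResponseNear (Φ : V → E) (L : V → V →ₗ[ℝ] E) {K : Set V} {M R : ℝ}
    (hM : 0 ≤ M) (hT : ∀ w ∈ K, ∀ w' ∈ K, ‖w' - w‖ ≤ R → ‖Φ w' - Φ w - L w (w' - w)‖ ≤ M * ‖w' - w‖ ^ 2)
    {c : V} (hc : c ∈ K) (hKR : ∀ w ∈ K, ‖w - c‖ ≤ R)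
    {w : V} (hw : w ∈ K) {s : ℝ} (hs : 1 ≤ s) (hws : c + s • (w - c) ∈ K) :
    ‖(Φ (c + s • (w - c)) - Φ c - L c (s • (w - c))) - (Φ (c + (w - c)) - Φ c - L c (w - c))‖
      ≤ 3 * M * R ^ 2 * (s - 1) := by
  set z : V := w - c with hz
  have hcw : c + z = w := by rw [hz]; abel
  have hzR : ‖z‖ ≤ R := hKR w hw
  have hs0 : 0 ≤ s - 1 := by linarith
  have hszR : s * ‖z‖ ≤ R := by
    have h := hKR _ hws
    rwa [add_sub_cancel_left, norm_smul, Real.norm_of_nonneg (by linarith)] at h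
  have hs1zR : (s - 1) * ‖z‖ ≤ R := by nlinarith [norm_nonneg z]
  have hincr : c + s • z - w = (s - 1) • z := by
    rw [← hcw, sub_smul, one_smul]; abel
  -- the near pair (w, c + s•z): distance (s−1)‖z‖ ≤ R
  have hA : ‖Φ (c + s • z) - Φ w - L w ((s - 1) • z)‖ ≤ M * ((s - 1) * ‖z‖) ^ 2 := by
    have h := hT w hw (c + s • z) hws (by rw [hincr, norm_smul, Real.norm_of_nonneg hs0]; exact hs1zR)
    rw [hincr, norm_smul, Real.norm_of_nonneg hs0] at h
    exact h
  -- the near pair (c, w): distance ‖z‖ ≤ R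
  have hB : ‖L c z - L w z‖ ≤ 2 * M * ‖z‖ ^ 2 := by
    have h := linearisation_diff_le_of_quadraticResponseNear Φ L hT hc hw (by rw [show w - c = z from rfl]; exact hzR)
    rw [show w - c = z from rfl] at h
    exact h
  have hdec : (Φ (c + s • z) - Φ c - L c (s • z)) - (Φ (c + z) - Φ c - L c z)
      = (Φ (c + s • z) - Φ w - L w ((s - 1) • z)) - (s - 1) • (L c z - L w z) := by
    rw [hcw]
    simp only [map_smul, map_sub, smul_sub, sub_smul, one_smul]
    abel
  rw [hdec]
  calc ‖(Φ (c + s • z) - Φ w - L w ((s - 1) • z)) - (s - 1) • (L c z - L w z)‖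
      ≤ ‖Φ (c + s • z) - Φ w - L w ((s - 1) • z)‖ + ‖(s - 1) • (L c z - L w z)‖ := norm_sub_le _ _
    _ ≤ M * ((s - 1) * ‖z‖) ^ 2 + (s - 1) * (2 * M * ‖z‖ ^ 2) := by
        rw [norm_smul, Real.norm_of_nonneg hs0]
        exact add_le_add hA (mul_le_mul_of_nonneg_left hB hs0)
    _ ≤ 3 * M * R ^ 2 * (s - 1) := by
        have h1 : ((s - 1) * ‖z‖) ^ 2 ≤ (s - 1) * R ^ 2 := by
          have : ((s - 1) * ‖z‖) ^ 2 = (s - 1) * (((s - 1) * ‖z‖) * ‖z‖) := by ring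
          rw [this]
          exact mul_le_mul_of_nonneg_left (by nlinarith [norm_nonneg z]) hs0
        have h2 : ‖z‖ ^ 2 ≤ R ^ 2 := pow_le_pow_left₀ (norm_nonneg z) hzR 2
        nlinarith [mul_le_mul_of_nonneg_left h1 hM, mul_le_mul_of_nonneg_left h2 hM]

/-- radial transversality of one near-pair quadratic-response letter (file 1 §2 from the near letter). [textbook] -/
theorem radialTransversal_of_quadraticResponseNear (Φ : V → E) (L : V → V →ₗ[ℝ] E) {K : Set V} {M R c₀ : ℝ}
    (hM : 0 ≤ M) (hT : ∀ w ∈ K, ∀ w' ∈ K, ‖w' - w‖ ≤ R → ‖Φ w' - Φ w - L w (w' - w)‖ ≤ M * ‖w' - w‖ ^ 2)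
    {c : V} (hc : c ∈ K) (hKR : ∀ w ∈ K, ‖w - c‖ ≤ R) (hc₀ : ‖Φ c‖ ≤ c₀)
    {w : V} (hw : w ∈ K) {s : ℝ} (hs : 1 ≤ s) (hws : c + s • (w - c) ∈ K) :
    ‖Φ w‖ + (s - 1) * (‖Φ w‖ - (c₀ + 4 * M * R ^ 2)) ≤ ‖Φ (c + s • (w - c))‖ := by
  set z : V := w - c with hz
  set G : V → E := fun v => Φ (c + v) - Φ c - L c v with hG
  have hcw : c + z = w := by rw [hz]; abel
  have hzR : ‖z‖ ≤ R := hKR w hw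
  have hs0 : 0 ≤ s - 1 := by linarith
  have hGrad : ‖G (s • z) - G z‖ ≤ 3 * M * R ^ 2 * (s - 1) :=
    radialRemainder_le_of_quadraticResponseNear Φ L hM hT hc hKR hw hs hws
  have h20 := affine_radialTransversal_perturbed (Φ c) (L c) G z hs hGrad
  have hw' : Φ c + L c z + G z = Φ w := by rw [hG]; simp only; rw [hcw]; abel
  have hsw : Φ c + L c (s • z) + G (s • z) = Φ (c + s • z) := by rw [hG]; simp only; abel
  rw [hw', hsw] at h20
  have hGz : ‖G z‖ ≤ M * R ^ 2 := by
    have h := hT c hc w hw (by rw [show w - c = z from rfl]; exact hzR)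
    have : G z = Φ w - Φ c - L c (w - c) := by rw [hG]; simp only; rw [hcw]
    rw [this]
    exact h.trans (mul_le_mul_of_nonneg_left (pow_le_pow_left₀ (norm_nonneg _) hzR 2) hM)
  have hmono : (s - 1) * (‖Φ w‖ - (c₀ + 4 * M * R ^ 2))
      ≤ (s - 1) * (‖Φ w‖ - ‖Φ c‖ - ‖G z‖ - 3 * M * R ^ 2) :=
    mul_le_mul_of_nonneg_left (by linarith) hs0
  linarith

/-- the cube sup of near-pair quadratic-response letters is radially transversal (file 1 §2, `iSup` form). [textbook] -/
theorem radialTransversal_iSup_of_quadraticResponseNear {P : Type*} [Fintype P] [Nonempty P]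
    (Φ : P → V → E) (L : P → V → V →ₗ[ℝ] E) {K : Set V} {M R c₀ : ℝ}
    (hM : 0 ≤ M)
    (hT : ∀ q, ∀ w ∈ K, ∀ w' ∈ K, ‖w' - w‖ ≤ R → ‖Φ q w' - Φ q w - L q w (w' - w)‖ ≤ M * ‖w' - w‖ ^ 2)
    {c : V} (hc : c ∈ K) (hKR : ∀ w ∈ K, ‖w - c‖ ≤ R) (hc₀ : ∀ q, ‖Φ q c‖ ≤ c₀)
    {w : V} (hw : w ∈ K) {s : ℝ} (hs : 1 ≤ s) (hws : c + s • (w - c) ∈ K) :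
    (⨆ q, ‖Φ q w‖) + (s - 1) * ((⨆ q, ‖Φ q w‖) - (c₀ + 4 * M * R ^ 2)) ≤ ⨆ q, ‖Φ q (c + s • (w - c))‖ :=
  radialTransversal_iSup (fun q v => ‖Φ q v‖) w (c + s • (w - c))
    fun q => radialTransversal_of_quadraticResponseNear (Φ q) (L q) hM (hT q) hc hKR (hc₀ q) hw hs hws

end Near

/-! ## §2  ★ Part 34's `hRT`, verbatim, from the near-pair letter -/

section Frame

variable {X V E : Type*} [NormedAddCommGroup V] [NormedSpace ℝ V] [NormedAddCommGroup E] [NormedSpace ℝ E]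
  {P : Type*} [Fintype P] [Nonempty P]

/-- ★ **PART 34's `hRT` FROM THE NEAR-PAIR LETTER** (file 1 §3 `hRT_of_quadraticResponse` with the letter asked only
for `‖w′ − w‖ ≤ R`): conclusion VERBATIM. [textbook] -/
theorem hRT_of_quadraticResponseNear (Φ : P → X → V → E) (L : P → X → V → V →ₗ[ℝ] E) (K : X → Set V) (c : X → V)
    {M R c₀ θ ρ κ₀ : ℝ} (hM : 0 ≤ M)
    (hT : ∀ q z, ∀ w ∈ K z, ∀ w' ∈ K z, ‖w' - w‖ ≤ R →
      ‖Φ q z w' - Φ q z w - L q z w (w' - w)‖ ≤ M * ‖w' - w‖ ^ 2)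
    (hcK : ∀ z, c z ∈ K z) (hKR : ∀ z, ∀ w ∈ K z, ‖w - c z‖ ≤ R) (hc₀ : ∀ q z, ‖Φ q z (c z)‖ ≤ c₀)
    {C : Set (X × V)} (hCK : ∀ p ∈ C, p.2 ∈ K p.1)
    (hnum : c₀ + 4 * M * R ^ 2 ≤ (1 - κ₀) * (θ * (1 - ρ))) :
    ∀ p : X × V, θ * (1 - ρ) ≤ (⨆ q, ‖Φ q p.1 p.2‖) → (⨆ q, ‖Φ q p.1 p.2‖) < θ → p ∈ C → ∀ s : ℝ, 1 ≤ s →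
      θ * (1 - ρ) ≤ (⨆ q, ‖Φ q p.1 (c p.1 + s • (p.2 - c p.1))‖) →
        (⨆ q, ‖Φ q p.1 (c p.1 + s • (p.2 - c p.1))‖) < θ → (p.1, c p.1 + s • (p.2 - c p.1)) ∈ C →
          (⨆ q, ‖Φ q p.1 p.2‖) + κ₀ * (θ * (1 - ρ)) * (s - 1) ≤ ⨆ q, ‖Φ q p.1 (c p.1 + s • (p.2 - c p.1))‖ := by
  intro p hlo _ hpC s hs _ _ hsC
  have hw : p.2 ∈ K p.1 := hCK p hpC
  have hws : c p.1 + s • (p.2 - c p.1) ∈ K p.1 := hCK _ hsC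
  have h2 := radialTransversal_iSup_of_quadraticResponseNear (fun q => Φ q p.1) (fun q => L q p.1) hM
    (fun q => hT q p.1) (hcK p.1) (hKR p.1) (fun q => hc₀ q p.1) hw hs hws
  have hs0 : 0 ≤ s - 1 := by linarith
  have hstep : (s - 1) * (κ₀ * (θ * (1 - ρ)))
      ≤ (s - 1) * ((⨆ q, ‖Φ q p.1 p.2‖) - (c₀ + 4 * M * R ^ 2)) :=
    mul_le_mul_of_nonneg_left (by linarith) hs0
  linarith

end Frame

/-! ## §3  ★′ File 2's ★ with the radius binder halved: `R < r` -/

section Analytic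

variable {X : Type*} {κ : Type*} [Fintype κ] {E : Type*} [NormedAddCommGroup E] [NormedSpace ℂ E]
  [CompleteSpace E] {P : Type*} [Fintype P] [Nonempty P]

/-- ★′ **PART 34's `hRT` FOR AN ANALYTIC RESPONSE WITH `R < r`** (file 2 ★ `hRT_of_analyticResponse` with
`hRr : 2 * R < r` replaced by `R < r`): the Cauchy rung is applied per NEAR pair (`‖x′ − x‖ ≤ R < r`), every other
binder and the conclusion VERBATIM. [textbook] -/
theorem hRT_of_analyticResponse_near (Φ : P → X → (κ → ℂ) → E) (K : X → Set (κ → ℝ)) (c : X → (κ → ℝ))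
    {r B R c₀ θ ρ κ₀ : ℝ} (hB0 : 0 ≤ B)
    (hd : ∀ q z, ∀ x ∈ K z, DifferentiableOn ℂ (Φ q z) (ball (fun i => (x i : ℂ)) r))
    (hB : ∀ q z, ∀ x ∈ K z, MapsTo (Φ q z) (ball (fun i => (x i : ℂ)) r) (closedBall (Φ q z fun i => (x i : ℂ)) B))
    (hcK : ∀ z, c z ∈ K z) (hKR : ∀ z, ∀ w ∈ K z, ‖w - c z‖ ≤ R) (hRr : R < r)
    (hc₀ : ∀ q z, ‖Φ q z (fun i => (c z i : ℂ))‖ ≤ c₀)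
    {C : Set (X × (κ → ℝ))} (hCK : ∀ p ∈ C, p.2 ∈ K p.1)
    (hnum : c₀ + 4 * (2 * B / r ^ 2) * R ^ 2 ≤ (1 - κ₀) * (θ * (1 - ρ))) :
    ∀ p : X × (κ → ℝ), θ * (1 - ρ) ≤ (⨆ q, ‖Φ q p.1 (fun i => (p.2 i : ℂ))‖) →
      (⨆ q, ‖Φ q p.1 (fun i => (p.2 i : ℂ))‖) < θ → p ∈ C → ∀ s : ℝ, 1 ≤ s →
      θ * (1 - ρ) ≤ (⨆ q, ‖Φ q p.1 (fun i => ((c p.1 + s • (p.2 - c p.1)) i : ℂ))‖) →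
        (⨆ q, ‖Φ q p.1 (fun i => ((c p.1 + s • (p.2 - c p.1)) i : ℂ))‖) < θ →
          (p.1, c p.1 + s • (p.2 - c p.1)) ∈ C →
          (⨆ q, ‖Φ q p.1 (fun i => (p.2 i : ℂ))‖) + κ₀ * (θ * (1 - ρ)) * (s - 1)
            ≤ ⨆ q, ‖Φ q p.1 (fun i => ((c p.1 + s • (p.2 - c p.1)) i : ℂ))‖ := by
  -- the real-linear embedding ι of the block frame and the realified derivative, as in file 2 §3
  let ι : (κ → ℝ) →ₗ[ℝ] (κ → ℂ) :=
    { toFun := fun x i => (x i : ℂ)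
      map_add' := fun x y => by ext i; simp
      map_smul' := fun a x => by ext i; simp }
  have hι : ∀ x, ι x = fun i => (x i : ℂ) := fun x => rfl
  -- the Cauchy rung on NEAR pairs: `‖x′ − x‖ ≤ R < r`
  have hT : ∀ q z, ∀ x ∈ K z, ∀ x' ∈ K z, ‖x' - x‖ ≤ R →
      ‖Φ q z (fun i => (x' i : ℂ)) - Φ q z (fun i => (x i : ℂ)) -
          (((fderiv ℂ (Φ q z) (ι x)).restrictScalars ℝ).toLinearMap.comp ι) (x' - x)‖
        ≤ 2 * B / r ^ 2 * ‖x' - x‖ ^ 2 := by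
    intro q z x hx x' hx' hnear
    have hιsub : ι x' - ι x = ι (x' - x) := (map_sub ι x' x).symm
    have hnorm : ‖ι x' - ι x‖ = ‖x' - x‖ := by rw [hιsub]; exact norm_realToComplex_pi (x' - x)
    have hlt : ‖ι x' - ι x‖ < r := by rw [hnorm]; exact lt_of_le_of_lt hnear hRr
    have hd' : DifferentiableOn ℂ (Φ q z) (ball (ι x) r) := hd q z x hx
    have hB' : MapsTo (Φ q z) (ball (ι x) r) (closedBall (Φ q z (ι x)) B) := hB q z x hx
    have h := quadraticRemainder_of_differentiableOn_ball (Φ q z) hd' hB' hlt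
    rw [hnorm, hιsub] at h
    exact h
  have hM : 0 ≤ 2 * B / r ^ 2 := by positivity
  exact hRT_of_quadraticResponseNear (fun q z x => Φ q z fun i => (x i : ℂ))
    (fun q z x => ((fderiv ℂ (Φ q z) (ι x)).restrictScalars ℝ).toLinearMap.comp ι) K c hM hT hcK hKR
    (fun q z => hc₀ q z) hCK hnum

end Analytic

/-! ## §4  ★★★′ File 8's ★★★ through the exponential block chart with `R < r` -/

section Chart

variable {𝔄 : Type*} [NormedRing 𝔄] [NormedAlgebra ℂ 𝔄] [CompleteSpace 𝔄] [NormOneClass 𝔄]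
  {κ B : Type*} [Fintype κ] [Fintype B]
  {Z P E : Type*} [NormedAddCommGroup E] [NormedSpace ℂ E]

/-- ★★★′ **PART 34's `hRT` FOR THE CUBE SUP OF PLAQUETTE READINGS OF THE MINIMISER THROUGH THE EXPONENTIAL BLOCK
CHART, `R < r`** (file 8 ★★★ `hRT_of_blockExpChart_regular` with `hRr : 2 * R < r` replaced by `R < r`; every other
binder and the conclusion VERBATIM: file 8's `cutLetters_of_blockExpChart_regular` + §3). [textbook] -/
theorem hRT_of_blockExpChart_regular_near [CompleteSpace E] [Fintype P] [Nonempty P] (Xd : Z → κ → B → 𝔄)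
    (V₀ : Z → B → 𝔄ˣ)
    {Ξ v v' r S δ ε ϱ R c₀ θ ρ κ₀ : ℝ} (hΞ0 : 0 ≤ Ξ) (hΞ : ∀ z b, ∑ a, ‖Xd z a b‖ ≤ Ξ) (hv0 : 0 ≤ v)
    (hv : ∀ z b, ‖(V₀ z b : 𝔄)‖ ≤ v) (hv' : ∀ z b, ‖(↑(V₀ z b)⁻¹ : 𝔄)‖ ≤ v') (hr : 0 < r) (hS0 : 0 ≤ S)
    (hsmall : Ξ * Real.exp ((ϱ + r) * Ξ) * v * r * (v' * Real.exp (ϱ * Ξ)) ≤ 1 / 2)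
    (plaqs : Finset (B × B × B × B))
    (hbudget : δ + max (Real.exp (ϱ * Ξ) * v + Ξ * Real.exp ((ϱ + r) * Ξ) * v * r)
        (2 * (v' * Real.exp (ϱ * Ξ))) ^ 3 * (2 + 4 * (v' * Real.exp (ϱ * Ξ)) ^ 2) *
        (Ξ * Real.exp ((ϱ + r) * Ξ) * v * r) < ε)
    (Ψ : P → Z → (B → 𝔄) → E)
    (hΨd : ∀ q z, DifferentiableOn ℂ (Ψ q z) {V : B → 𝔄 | (∀ b, IsUnit (V b)) ∧ ∀ p ∈ plaqs,
      ‖V p.1 * V p.2.1 * Ring.inverse (V p.2.2.1) * Ring.inverse (V p.2.2.2) - 1‖ < ε})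
    (hΨS : ∀ q z, ∀ V ∈ {V : B → 𝔄 | (∀ b, IsUnit (V b)) ∧ ∀ p ∈ plaqs,
      ‖V p.1 * V p.2.1 * Ring.inverse (V p.2.2.1) * Ring.inverse (V p.2.2.2) - 1‖ < ε}, ‖Ψ q z V‖ ≤ S)
    (K : Z → Set (κ → ℝ)) (hKϱ : ∀ z, ∀ x ∈ K z, ‖x‖ ≤ ϱ)
    (hreg : ∀ z, ∀ x ∈ K z, ∀ p ∈ plaqs,
      ‖exp (∑ a, (x a : ℂ) • Xd z a p.1) * (V₀ z p.1 : 𝔄) * (exp (∑ a, (x a : ℂ) • Xd z a p.2.1) * (V₀ z p.2.1 : 𝔄)) *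
        Ring.inverse (exp (∑ a, (x a : ℂ) • Xd z a p.2.2.1) * (V₀ z p.2.2.1 : 𝔄)) *
        Ring.inverse (exp (∑ a, (x a : ℂ) • Xd z a p.2.2.2) * (V₀ z p.2.2.2 : 𝔄)) - 1‖ ≤ δ)
    (c : Z → (κ → ℝ)) (hcK : ∀ z, c z ∈ K z) (hKR : ∀ z, ∀ w ∈ K z, ‖w - c z‖ ≤ R) (hRr : R < r)
    (hc₀ : ∀ q z, ‖Ψ q z (fun b => exp (∑ a, ((c z a : ℝ) : ℂ) • Xd z a b) * (V₀ z b : 𝔄))‖ ≤ c₀)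
    {C : Set (Z × (κ → ℝ))} (hCK : ∀ p ∈ C, p.2 ∈ K p.1)
    (hnum : c₀ + 4 * (2 * (2 * S) / r ^ 2) * R ^ 2 ≤ (1 - κ₀) * (θ * (1 - ρ))) :
    ∀ p : Z × (κ → ℝ),
      θ * (1 - ρ) ≤ (⨆ q, ‖Ψ q p.1 (fun b => exp (∑ a, ((p.2 a : ℝ) : ℂ) • Xd p.1 a b) * (V₀ p.1 b : 𝔄))‖) →
      (⨆ q, ‖Ψ q p.1 (fun b => exp (∑ a, ((p.2 a : ℝ) : ℂ) • Xd p.1 a b) * (V₀ p.1 b : 𝔄))‖) < θ → p ∈ C →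
      ∀ s : ℝ, 1 ≤ s →
      θ * (1 - ρ) ≤ (⨆ q, ‖Ψ q p.1 (fun b =>
        exp (∑ a, (((c p.1 + s • (p.2 - c p.1)) a : ℝ) : ℂ) • Xd p.1 a b) * (V₀ p.1 b : 𝔄))‖) →
      (⨆ q, ‖Ψ q p.1 (fun b =>
        exp (∑ a, (((c p.1 + s • (p.2 - c p.1)) a : ℝ) : ℂ) • Xd p.1 a b) * (V₀ p.1 b : 𝔄))‖) < θ →
      (p.1, c p.1 + s • (p.2 - c p.1)) ∈ C →
      (⨆ q, ‖Ψ q p.1 (fun b => exp (∑ a, ((p.2 a : ℝ) : ℂ) • Xd p.1 a b) * (V₀ p.1 b : 𝔄))‖) +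
          κ₀ * (θ * (1 - ρ)) * (s - 1) ≤
        ⨆ q, ‖Ψ q p.1 (fun b =>
          exp (∑ a, (((c p.1 + s • (p.2 - c p.1)) a : ℝ) : ℂ) • Xd p.1 a b) * (V₀ p.1 b : 𝔄))‖ := by
  obtain ⟨hd, hB⟩ := cutLetters_of_blockExpChart_regular Xd V₀ hΞ0 hΞ hv0 hv hv' hr hsmall plaqs hbudget Ψ hΨd hΨS K
    hKϱ hreg
  exact hRT_of_analyticResponse_near (fun q z w => Ψ q z fun b => exp (∑ a, w a • Xd z a b) * (V₀ z b : 𝔄)) K c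
    (B := 2 * S) (by positivity) hd hB hcK hKR hRr hc₀ hCK hnum

end Chart

end Summit.QuantumFields.YangMills.Theorems.N21ResponseRadialTransversalityNear

end
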